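import Mathlib
import Literature.Analysis.FluidPDE.Vorticity
import HarnessLib

/-!
# Route `ScaledTopAlignment`: slice selection under a square-integrable-in-time majorant, and
# differentiability of the vorticity direction (tools for the tree's discharge of Giga–Miura 2011,
# Cor. 2.6, `ScaledTopAlignmentGigaMiuraDirectionGradient`; support for the deciding crux W3ᵐᵗ =
# `AprioriMostTimesBulkAlignment`, stmt-NavierStokesRegularity-19551; no import of the route file)

Giga–Miura 2011, Cor. 2.6 (HUPS #956 p. 9) assumes `∫ ‖∇ζ(t)‖²_{L^∞(Ω_d(t))} dt < ∞` — a hypothesis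
that is INTEGRATED IN TIME and SCALING INVARIANT. Under the Type-I zoom `t = T + λ_j² s/ν`,
`y ↦ x_j + λ_j y`, the zoomed direction fields have gradient bound `H_j(s) = λ_j g(T + λ_j² s/ν)`
(`g` a majorant of the printed `L^∞` norm), and scaling invariance is exactly the statement that
`∫_{(a,b)} H_j(s)² ds = ν ∫_{(T + λ_j² a/ν, T + λ_j² b/ν)} g(t)² dt` — a tail of the finite integral
`∫_{(0,T)} g²`, which tends to zero. Fatou then gives `liminf_j H_j(s)² = 0` for a.e. slice `s`, hence
a slice `s₀ ∈ (a, b)` at which `H_j(s₀) < η` frequently in `j`, for every `η > 0`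
(`exists_slice_frequently_lt_of_sqIntegrable`). This is the "selection of an a.e. slice" step of the
discharge; the other two declarations are the affine substitution it uses
(`setLIntegral_Ioo_comp_add_mul`) and the differentiability of `ξ = ω/|ω|` away from `ω = 0`
(`differentiableAt_vorticityDirection`), used for the mean-value step.
WHAT THIS IS NOT: not NS regularity; measure theory and calculus only.

## References
* Y. Giga, H. Miura, Comm. Math. Phys. 303 (2011) 289–300 = HUPS #956: Cor. 2.6, Rmk. 2.7–2.8
  (pp. 9–10). [GigaMiura2011]
-/

noncomputable section

-- the summit and its single sub-problem share the name (CONVENTIONS §1), as in every Theorems file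
set_option linter.dupNamespace false

open MeasureTheory Set Function Filter Topology Metric
open scoped RealInnerProductSpace ENNReal NNReal

namespace Summit.NavierStokesRegularity.NavierStokesRegularity.Theorems

open Literature.Analysis Literature.Analysis.FluidPDE

/-! ### Two elementary lemmas -/

/-- Affine substitution `t = c + μ s` (`μ > 0`) in a lower integral over an interval:
`∫_{(a,b)} G(c + μ s) ds = μ⁻¹ ∫_{(c + μ a, c + μ b)} G(t) dt`, for every `G : ℝ → [0, ∞]`
(Mathlib's `Real.map_volume_mul_left`, `lintegral_map_equiv`, `lintegral_add_right_eq_self`).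
[folklore] -/
theorem setLIntegral_Ioo_comp_add_mul {μ : ℝ} (hμ : 0 < μ) (c a b : ℝ) (G : ℝ → ℝ≥0∞) :
    ∫⁻ s in Ioo a b, G (c + μ * s) =
      ENNReal.ofReal μ⁻¹ * ∫⁻ t in Ioo (c + μ * a) (c + μ * b), G t := by
  -- adapted from the tree's `Literature.Analysis.FluidPDE.lintegral_comp_mul_add` (TaoY6RadialChange)
  set Φ : ℝ → ℝ≥0∞ := (Ioo (c + μ * a) (c + μ * b)).indicator G with hΦ
  have hind : ∀ s, (Ioo a b).indicator (fun s => G (c + μ * s)) s = Φ (μ * s + c) := by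
    intro s
    by_cases hs : s ∈ Ioo a b
    · have hs' : μ * s + c ∈ Ioo (c + μ * a) (c + μ * b) :=
        ⟨by nlinarith [hs.1], by nlinarith [hs.2]⟩
      rw [indicator_of_mem hs, hΦ, indicator_of_mem hs', add_comm]
    · have hs' : μ * s + c ∉ Ioo (c + μ * a) (c + μ * b) := by
        intro h
        exact hs ⟨by nlinarith [h.1], by nlinarith [h.2]⟩
      rw [indicator_of_notMem hs, hΦ, indicator_of_notMem hs']
  rw [← lintegral_indicator measurableSet_Ioo, ← lintegral_indicator measurableSet_Ioo]
  simp_rw [hind]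
  have h1 : ∫⁻ r, Φ (μ * r + c) = ∫⁻ r, Φ (μ * r) := by
    have h := lintegral_add_right_eq_self (μ := (volume : Measure ℝ)) (fun r => Φ (μ * r)) (c / μ)
    rw [← h]
    refine lintegral_congr fun r => ?_
    congr 1
    field_simp
  rw [h1]
  have h2 : ∫⁻ r, Φ (μ * r) = ∫⁻ s, Φ s ∂(Measure.map (μ * ·) volume) :=
    (lintegral_map_equiv Φ (Homeomorph.mulLeft₀ μ hμ.ne').toMeasurableEquiv).symm
  rw [h2, Real.map_volume_mul_left hμ.ne', lintegral_smul_measure, abs_of_pos (inv_pos.2 hμ),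
    smul_eq_mul]

/-- The vorticity direction `ξ = ω/|ω|` is differentiable wherever `ω` is differentiable and
non-zero. [folklore] -/
theorem differentiableAt_vorticityDirection
    {ω : EuclideanSpace ℝ (Fin 3) → EuclideanSpace ℝ (Fin 3)} {x : EuclideanSpace ℝ (Fin 3)}
    (hω : DifferentiableAt ℝ ω x) (hx : ω x ≠ 0) :
    DifferentiableAt ℝ (vorticityDirection ω) x := by
  have h1 : DifferentiableAt ℝ (fun y => ‖ω y‖) x := hω.norm ℝ hx
  have h2 : DifferentiableAt ℝ (fun y => ‖ω y‖⁻¹) x := h1.inv (norm_ne_zero_iff.2 hx)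
  show DifferentiableAt ℝ (fun y => ‖ω y‖⁻¹ • ω y) x
  exact h2.smul hω

/-! ### Slice selection under a square-integrable-in-time majorant -/

/-- **Selection of an a.e. slice.** Let `g : ℝ → [0, ∞]` be measurable with `∫_{(0,T)} g² < ∞`
(`T > 0`, `ν > 0`), let `λ_j > 0`, `λ_j → 0`, and let `a < b < 0`. Then some slice `s₀ ∈ (a, b)`
has `λ_j g(T + λ_j² s₀/ν) < η` frequently in `j`, for every `η > 0`: the scaled majorants
`H_j(s) = λ_j g(T + λ_j² s/ν)` satisfy `∫_{(a,b)} H_j² = ν ∫_{(T + λ_j² a/ν, T + λ_j² b/ν)} g² → 0`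
(affine substitution + absolute continuity of the finite integral, `tendsto_setLIntegral_zero`), so
`liminf_j H_j(s)² = 0` for a.e. `s ∈ (a, b)` by Fatou (`lintegral_liminf_le'`). [folklore] -/
theorem exists_slice_frequently_lt_of_sqIntegrable {ν T : ℝ} (hν : 0 < ν) (hT : 0 < T)
    {g : ℝ → ℝ≥0∞} (hgm : Measurable g) (hg2 : (∫⁻ t in Ioo 0 T, g t ^ 2) < ∞)
    {lam : ℕ → ℝ} (hlam : ∀ j, 0 < lam j) (hlam0 : Tendsto lam atTop (𝓝 0))
    {a b : ℝ} (hab : a < b) (hb : b < 0) :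
    ∃ s₀ ∈ Ioo a b, ∀ η : ℝ, 0 < η → ∃ᶠ j in atTop,
      ENNReal.ofReal (lam j) * g (T + lam j ^ 2 / ν * s₀) < ENNReal.ofReal η := by
  have hc : ∀ j, 0 < lam j ^ 2 / ν := fun j => div_pos (pow_pos (hlam j) 2) hν
  have hc0 : Tendsto (fun j => lam j ^ 2 / ν) atTop (𝓝 0) := by
    have h := (hlam0.pow 2).div_const ν
    rw [zero_pow two_ne_zero, zero_div] at h
    exact h
  set H : ℕ → ℝ → ℝ≥0∞ := fun j s => ENNReal.ofReal (lam j) * g (T + lam j ^ 2 / ν * s) with hHdef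
  have hgc : ∀ j, Measurable fun s : ℝ => g (T + lam j ^ 2 / ν * s) := fun j =>
    hgm.comp ((measurable_id.const_mul (lam j ^ 2 / ν)).const_add T)
  have hHm : ∀ j, Measurable (H j) := fun j => (hgc j).const_mul _
  -- the change of variables
  have hInt : ∀ j, ∫⁻ s in Ioo a b, H j s ^ 2 =
      ENNReal.ofReal ν * ∫⁻ t in Ioo (T + lam j ^ 2 / ν * a) (T + lam j ^ 2 / ν * b), g t ^ 2 := by
    intro j
    have e1 : (fun s => H j s ^ 2) =
        fun s => ENNReal.ofReal (lam j) ^ 2 * g (T + lam j ^ 2 / ν * s) ^ 2 := by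
      funext s; simp only [hHdef]; rw [mul_pow]
    have h3 : ∫⁻ s in Ioo a b, g (T + lam j ^ 2 / ν * s) ^ 2 = ENNReal.ofReal (lam j ^ 2 / ν)⁻¹ *
        ∫⁻ t in Ioo (T + lam j ^ 2 / ν * a) (T + lam j ^ 2 / ν * b), g t ^ 2 :=
      setLIntegral_Ioo_comp_add_mul (hc j) T a b (fun t => g t ^ 2)
    have e2 : ENNReal.ofReal (lam j) ^ 2 * ENNReal.ofReal (lam j ^ 2 / ν)⁻¹ = ENNReal.ofReal ν := by
      rw [← ENNReal.ofReal_pow (hlam j).le, ← ENNReal.ofReal_mul (pow_nonneg (hlam j).le 2)]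
      congr 1
      have hl : lam j ^ 2 ≠ 0 := pow_ne_zero 2 (hlam j).ne'
      rw [div_eq_mul_inv, mul_inv, inv_inv, ← mul_assoc, mul_inv_cancel₀ hl, one_mul]
    rw [e1, lintegral_const_mul _ ((hgc j).pow_const 2), h3, ← mul_assoc, e2]
  -- the physical windows shrink into `(0, T)` and their length tends to zero
  have hsub : ∀ᶠ j in atTop, Ioo (T + lam j ^ 2 / ν * a) (T + lam j ^ 2 / ν * b) ⊆ Ioo 0 T := by
    have h1 : Tendsto (fun j => lam j ^ 2 / ν * (-a)) atTop (𝓝 (0 * (-a))) := hc0.mul_const _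
    rw [zero_mul] at h1
    filter_upwards [h1.eventually_lt_const hT] with j hj
    intro t ht
    have hb' : lam j ^ 2 / ν * b < 0 := mul_neg_of_pos_of_neg (hc j) hb
    exact ⟨by linarith [ht.1], by linarith [ht.2]⟩
  have hvol : Tendsto (fun j => (volume.restrict (Ioo 0 T))
      (Ioo (T + lam j ^ 2 / ν * a) (T + lam j ^ 2 / ν * b))) atTop (𝓝 0) := by
    have h1 : Tendsto (fun j => ENNReal.ofReal (lam j ^ 2 / ν * (b - a))) atTop
        (𝓝 (ENNReal.ofReal (0 * (b - a)))) := ENNReal.tendsto_ofReal (hc0.mul_const _)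
    rw [zero_mul, ENNReal.ofReal_zero] at h1
    refine tendsto_of_tendsto_of_tendsto_of_le_of_le tendsto_const_nhds h1 (fun _ => zero_le)
      fun j => ?_
    calc (volume.restrict (Ioo 0 T)) (Ioo (T + lam j ^ 2 / ν * a) (T + lam j ^ 2 / ν * b))
        ≤ volume (Ioo (T + lam j ^ 2 / ν * a) (T + lam j ^ 2 / ν * b)) :=
          Measure.le_iff'.1 Measure.restrict_le_self _
      _ = ENNReal.ofReal (lam j ^ 2 / ν * (b - a)) := by
          rw [Real.volume_Ioo]; ring_nf
  have htail : Tendsto (fun j => ∫⁻ t in Ioo (T + lam j ^ 2 / ν * a) (T + lam j ^ 2 / ν * b),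
      g t ^ 2 ∂(volume.restrict (Ioo 0 T))) atTop (𝓝 0) :=
    tendsto_setLIntegral_zero (μ := volume.restrict (Ioo 0 T))
      (s := fun j => Ioo (T + lam j ^ 2 / ν * a) (T + lam j ^ 2 / ν * b)) hg2.ne hvol
  have hL2 : Tendsto (fun j => ∫⁻ s in Ioo a b, H j s ^ 2) atTop (𝓝 0) := by
    have h1 : Tendsto (fun j => ENNReal.ofReal ν *
        ∫⁻ t in Ioo (T + lam j ^ 2 / ν * a) (T + lam j ^ 2 / ν * b),
          g t ^ 2 ∂(volume.restrict (Ioo 0 T))) atTop (𝓝 0) := by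
      have h := ENNReal.Tendsto.const_mul (a := ENNReal.ofReal ν) htail (Or.inr ENNReal.ofReal_ne_top)
      rwa [mul_zero] at h
    refine h1.congr' ?_
    filter_upwards [hsub] with j hj
    rw [hInt j, Measure.restrict_restrict measurableSet_Ioo, inter_eq_self_of_subset_left hj]
  -- Fatou
  have hFatou : ∫⁻ s in Ioo a b, liminf (fun j => H j s ^ 2) atTop = 0 := by
    refine le_antisymm ?_ zero_le
    calc ∫⁻ s in Ioo a b, liminf (fun j => H j s ^ 2) atTop
        ≤ liminf (fun j => ∫⁻ s in Ioo a b, H j s ^ 2) atTop :=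
          lintegral_liminf_le' fun j => ((hHm j).pow_const 2).aemeasurable
      _ = 0 := hL2.liminf_eq
  have hae0 : ∀ᵐ s ∂(volume.restrict (Ioo a b)), liminf (fun j => H j s ^ 2) atTop = 0 := by
    have h := (lintegral_eq_zero_iff' (Measurable.liminf fun j => (hHm j).pow_const 2).aemeasurable).1
      hFatou
    filter_upwards [h] with s hs
    simpa using hs
  -- an admissible slice `s₀ ∈ (a, b)`
  have hab0 : volume (Ioo a b) ≠ 0 := by
    rw [Real.volume_Ioo]; exact (ENNReal.ofReal_pos.2 (by linarith)).ne'
  haveI : (ae (volume.restrict (Ioo a b))).NeBot :=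
    ae_neBot.2 (by rwa [Ne, Measure.restrict_eq_zero])
  obtain ⟨s₀, hs₀mem, hs₀⟩ := ((ae_restrict_mem measurableSet_Ioo).and hae0).exists
  have hfreq : ∀ η : ℝ, 0 < η → ∃ᶠ j in atTop, H j s₀ < ENNReal.ofReal η := by
    intro η hη
    have hη' : (0 : ℝ≥0∞) < ENNReal.ofReal η ^ 2 := ENNReal.pow_pos (ENNReal.ofReal_pos.2 hη) 2
    have hlt : liminf (fun j => H j s₀ ^ 2) atTop < ENNReal.ofReal η ^ 2 := by rw [hs₀]; exact hη'
    refine (frequently_lt_of_liminf_lt (h := hlt)).mono fun j hj => ?_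
    by_contra hle
    have hge : ENNReal.ofReal η ≤ H j s₀ := not_lt.1 hle
    have : ENNReal.ofReal η ^ 2 ≤ H j s₀ ^ 2 := by gcongr
    exact absurd hj (not_lt.2 this)
  exact ⟨s₀, hs₀mem, hfreq⟩

end Summit.NavierStokesRegularity.NavierStokesRegularity.Theorems

end
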